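/-
Copyright (c) 2026 the pub-hodgecm-mathlib formalisation cell (harness21).  Prover seat hodgecm-mathlib-F0P3a-p08 (g19), 2026-09-02.  Road «S3-tree»∕«S3-ram» (LEAD F0P3a-plan (g12)
T11-41∕T11-52; owner p06 (g15)), row (e2)(b) «P-2-ram», organ «(D2-α)-ram»: the ramified-base twin of ★ F0P2-p06 (g11) `InertPlaceSkewDiscriminantRoot.exists_skew_sqrt_discriminant`
— the skew square root of the discriminant of a deep type-(2) unitary block at a tamely RAMIFIED CM place, WITH THE TORUS-TYPE BIT, and the eigenvalue norm identity it feeds.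
-/
import Literature.NumberTheory.Automorphic.RamifiedPlaceAntiFixedUniformizer        -- ★ `exists_uniformizer_galAdicCompletionMap_complexConj_eq_neg_of_ramified`
import Literature.NumberTheory.Automorphic.RamifiedPlaceEisensteinBasis            -- ★ ramified-place kit (brings ★ `exists_toPlace_eq_of_galAdicCompletionMap_eq`, `valued_galAdicCompletionMap`, …)
import HarnessLib

/-!
# The skew square root of the discriminant of a type-(2) unitary block at a tamely RAMIFIED CM place, with the type bit

Topic `NumberTheory/LocalFields`; namespace `Literature.NumberTheory.LocalFields`.  THEOREMS ONLY (no definition, no instance, no notation, no named fact, no `sorry`);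
kernel lane `--supports stmt-HodgeConjecture-24833`.  Cell `pub/hodgecm-mathlib` (D-0151), crux H413; road «S3-tree», seeding wave «S3-ram» (tame-ramified non-split `v ∤ 2`),
row (e2)(b) «P-2-ram»: the input `(y, ε₀, hD, hN, hns)` + type bit of ★ p847296 `TypeTwoUnitIndexAtRamifiedPlace` ∕ `TypeTwoUnitIndexAtRamifiedCMPlace` ((D5)-ram) and the
eigenvalue identity `λ·s̃λ = 1` (`hlam1`) for the R2²-ram one-place row (ramified twin of ★ `DepthZeroKappaTransferTypeTwoRowTwoPlace`).
HONEST LABEL: HC_CM is proved only modulo the 2 remaining named inputs (hLiu418 24832, h413 24833) until rung 0 closes; unconditional local algebra, count-neutral.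

THE MATHEMATICS.  `E = L_w ⊃ ι(L⁺_v)` at a place `w ∣ v` of the CM extension ramified in `L` with `|2|_w = 1`, `σ = σ_w`; `t, D` the trace and determinant of the irreducible
quadratic factor of a deep type-(2) unitary `τ`: `D·σD = 1`, `σt = t·σD`, `|D − 1| < 1`, `disc := t² − 4D` of EVEN order `2N` and maximally non-square (`|disc| ≤ |disc − z²|`
for all `z`, ★ F0P2-p02 `LocalIrreducibleTorusDiscriminantRamified`).  (1) `σ(disc) = σD²·disc` (from `DσD = 1`).  (2) HILBERT 90 WITH A UNIT: `f := 1 + σD` has `σf = 1 + D = D·f`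
and `|f| = |2| = 1` (`D ≡ 1`); hence `F := disc·f²` is `σ`-FIXED.  (3) With an anti-fixed uniformiser `ϖ` (★ `exists_uniformizer_galAdicCompletionMap_complexConj_eq_neg_of_ramified`),
`G := F ∕ ϖ^{2N}` is `σ`-fixed of valuation `1`, so `G = ι ε₀` (★ `exists_toPlace_eq_of_galAdicCompletionMap_eq`); then `disc = y²·ι ε₀` with `y := ϖ^N ∕ f`, `|y| = exp(−N)`, and
**`σy = (−1)^N · y · σD`** (`σϖ^N = (−1)^N ϖ^N`, `σf = D f`, `σD = D⁻¹`).  (4) `ι ε₀` is a residue non-square: `|b² − ι ε₀| < 1` with `|b| ≤ 1` would give `|disc − (b y)²| =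
|y|²·|ι ε₀ − b²| < |disc|`.  THE TYPE BIT: the adjoint involution `⋆` of `E[τ]` restricts on the eigen-field `K = E(θ)`, `θ² = ι ε₀`, `λ = (t + yθ)∕2`, to the extension `s̃` of `σ`
with `s̃θ = θ` (torus type A) or `s̃θ = −θ` (type B), and `λ⋆ = λ⁻¹` forces `θ⋆ = −(y∕σy)·σD·θ`; by (3) **type A ⟺ `N` odd, type B ⟺ `N` even** — A-p19 (g26)'s CERT-T2c-ram parity
law, here a theorem: with `s̃θ = (−1)^{N+1}θ`, `λ·s̃λ = e₂²·σD·(t + yθ)(t − yθ) = e₂²·σD·4D = 1` (§2, pure algebra).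

* §1 **`exists_skew_sqrt_discriminant_of_ramified`** `(w hw he h2) (hσD : DσD = 1) (hσt : σt = tσD) (hD1 : |D − 1| < 1) (hdisc : |t² − 4D| = exp(−2N)) (hsq : ∀ z, |t²−4D| ≤ |t²−4D−z²|) :
  ∃ y ε₀, (∀ b, |b| ≤ 1 → |b·b − ι ε₀| = 1) ∧ 4D = t·t − y·y·ι ε₀ ∧ |y| = exp(−N) ∧ σy = (−1)^N·(y·σD)`.
* §2 **`mul_map_mul_eq_one_of_skew_sqrt`** — over commutative rings `E →[ι₁] K` with `σ`, `s̃` (`s̃ ∘ ι₁ = ι₁ ∘ σ`), `θ² = ι₁ ε`, `σε = ε`, `s̃θ = −((−1)^N·θ)`, `4D = t·t − y·y·ε`,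
  `DσD = 1`, `σt = tσD`, `σy = (−1)^N·(y·σD)`, `e₂·2 = 1`: `((ι₁t + ι₁y·θ)·ι₁e₂) · s̃((ι₁t + ι₁y·θ)·ι₁e₂) = 1` — ★ (D5)-ram's binder `hlam1`; typed corollaries
  **`mul_map_mul_eq_one_of_skew_sqrt_typeA`** (`Odd N`, `s̃θ = θ`, `σy = −(y·σD)`) and **`…_typeB`** (`Even N`, `s̃θ = −θ`, `σy = y·σD`).

## References
* [Rogawski1990] J. D. Rogawski, *Automorphic Representations of Unitary Groups in Three Variables*, Annals of Math. Studies 123 (1990): §4.9 Lemma 4.9.3 p. 56; §3.6 p. 31.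
* [SerreLocalFields1979] J.-P. Serre, *Local Fields*, GTM 67 (1979): Ch. X §1 (Hilbert's Theorem 90), Ch. V §3, Ch. I §6 Prop. 18.
* [Jacobowitz1962] R. Jacobowitz, *Hermitian forms over local fields*, Amer. J. Math. 84 (1962): §5.
-/

set_option autoImplicit false

noncomputable section

open ValuativeRel NumberField IsDedekindDomain
open scoped ValuativeRel

namespace Literature.NumberTheory.LocalFields

open Literature.NumberTheory.Automorphic Literature.NumberTheory.Automorphic.UnitaryGroup

/-! ## §1 The skew square root of the discriminant at a tamely ramified CM place -/

set_option maxHeartbeats 1600000 in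
/-- **(D2-α)-ram: `t² − 4D = y²·ι ε₀` WITH `ε₀` A RESIDUE NON-SQUARE UNIT OF `L⁺_v`, `|y| = exp(−N)` AND `σ_w y = (−1)^N·y·σ_w D`** for the trace `t` and determinant `D`
of the irreducible quadratic factor of a deep type-(2) unitary block at a place `w ∣ v` of `L ∕ L⁺` ramified in `L` with `|2|_w = 1` (`DσD = 1`, `σt = tσD`, `|D − 1| < 1`,
`|t² − 4D| = exp(−2N)`, `t² − 4D` maximally non-square).  See the module docstring (Hilbert 90 with the unit `1 + σD`).
[cite: Rogawski1990, §4.9 Lemma 4.9.3 p. 56] [cite: SerreLocalFields1979, Ch. X §1 Prop. 2; Ch. V §3] [cite: Jacobowitz1962, §5] -/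
theorem exists_skew_sqrt_discriminant_of_ramified (L : Type) [Field L] [NumberField L] [IsCMField L]
    {v : HeightOneSpectrum (𝓞 ↥(maximalRealSubfield L))} (w : PlacesOver L v) (hw : IsCMField.complexConj L • w.1 = w.1)
    (he : v.asIdeal.ramificationIdx' w.1.asIdeal ≠ 1) (h2 : Valued.v (2 : w.1.adicCompletion L) = 1)
    {t D : w.1.adicCompletion L}
    (hσD : D * galAdicCompletionMap (L := L) (IsCMField.complexConj L) hw D = 1)
    (hσt : galAdicCompletionMap (L := L) (IsCMField.complexConj L) hw t = t * galAdicCompletionMap (L := L) (IsCMField.complexConj L) hw D)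
    (hD1 : Valued.v (D - 1) < 1)
    {N : ℕ} (hdisc : Valued.v (t ^ 2 - 4 * D) = WithZero.exp (-((2 * N : ℕ) : ℤ)))
    (hsq : ∀ z : w.1.adicCompletion L, Valued.v (t ^ 2 - 4 * D) ≤ Valued.v (t ^ 2 - 4 * D - z ^ 2)) :
    ∃ (y : w.1.adicCompletion L) (ε₀ : v.adicCompletion ↥(maximalRealSubfield L)),
      (∀ b : w.1.adicCompletion L, Valued.v b ≤ 1 → Valued.v (b * b - toPlace v w ε₀) = 1) ∧
      4 * D = t * t - y * y * toPlace v w ε₀ ∧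
      Valued.v y = WithZero.exp (-(N : ℤ)) ∧
      galAdicCompletionMap (L := L) (IsCMField.complexConj L) hw y =
        (-1) ^ N * (y * galAdicCompletionMap (L := L) (IsCMField.complexConj L) hw D) := by
  set σ := galAdicCompletionMap (L := L) (IsCMField.complexConj L) hw with hσdef
  have hc1 : IsCMField.complexConj L ≠ 1 := IsCMField.complexConj_ne_one L
  have hσσ : ∀ x, σ (σ x) = x := galAdicCompletionMap_galAdicCompletionMap_of_smul_eq (IsCMField.complexConj L) w hc1 hw
  have hσv : ∀ x, Valued.v (σ x) = Valued.v x := fun x => valued_galAdicCompletionMap (L := L) (IsCMField.complexConj L) hw x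
  have h20 : (2 : w.1.adicCompletion L) ≠ 0 := fun h => by rw [h, map_zero] at h2; exact zero_ne_one h2
  -- `|D| = 1`, `D ≠ 0`, `σD = D⁻¹`
  have hDv : Valued.v D = 1 := by
    have h := Valued.v.map_add_eq_of_lt_left (x := (1 : w.1.adicCompletion L)) (y := D - 1) (by rw [map_one]; exact hD1)
    rw [add_sub_cancel, map_one] at h
    exact h
  have hD0 : D ≠ 0 := fun h => by rw [h, map_zero] at hDv; exact zero_ne_one hDv
  have hσD' : σ D = D⁻¹ := eq_inv_of_mul_eq_one_right hσD
  -- the unit `f := 1 + σD` with `σf = D·f`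
  set f : w.1.adicCompletion L := 1 + σ D with hfdef
  have hfv : Valued.v f = 1 := by
    have hlt : Valued.v (σ (D - 1)) < Valued.v (2 : w.1.adicCompletion L) := by rw [hσv, h2]; exact hD1
    have h := Valued.v.map_add_eq_of_lt_left hlt
    rw [map_sub, map_one, h2] at h
    rw [hfdef, show (1 : w.1.adicCompletion L) + σ D = 2 + (σ D - 1) by ring]
    exact h
  have hf0 : f ≠ 0 := fun h => by rw [h, map_zero] at hfv; exact zero_ne_one hfv
  have hσf : σ f = D * f := by
    rw [hfdef, map_add, map_one, hσσ]
    linear_combination -hσD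
  -- `σ(disc) = σD²·disc` and `F := disc·f²` is fixed
  have hσdisc : σ (t ^ 2 - 4 * D) = σ D ^ 2 * (t ^ 2 - 4 * D) := by
    rw [map_sub, map_pow, map_mul, map_ofNat, hσt]
    linear_combination (4 * σ D) * hσD
  have hσF : σ ((t ^ 2 - 4 * D) * f ^ 2) = (t ^ 2 - 4 * D) * f ^ 2 := by
    rw [map_mul, map_pow, hσdisc, hσf]
    linear_combination ((t ^ 2 - 4 * D) * f ^ 2 * (D * σ D + 1)) * hσD
  -- an anti-fixed uniformiser `ϖ`; `ϖ^{2N}` is fixed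
  obtain ⟨ϖ, hϖv, hσϖ⟩ := exists_uniformizer_galAdicCompletionMap_complexConj_eq_neg_of_ramified L w hw he h2
  rw [← hσdef] at hσϖ
  have hϖ0 : (ϖ : w.1.adicCompletion L) ≠ 0 := ϖ.ne_zero
  have hσϖ2N : σ ((ϖ : w.1.adicCompletion L) ^ (2 * N)) = (ϖ : w.1.adicCompletion L) ^ (2 * N) := by
    rw [map_pow, hσϖ, pow_mul, neg_sq, pow_mul]
  -- `G := disc·f² ∕ ϖ^{2N}` is fixed, hence rational: `G = ι ε₀`
  set G : w.1.adicCompletion L := (t ^ 2 - 4 * D) * f ^ 2 / (ϖ : w.1.adicCompletion L) ^ (2 * N) with hGdef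
  have hσG : σ G = G := by rw [hGdef, map_div₀, hσF, hσϖ2N]
  obtain ⟨ε₀, hε₀⟩ := exists_toPlace_eq_of_galAdicCompletionMap_eq (IsCMField.complexConj L) w hc1 hw G hσG
  -- the square root `y := ϖ^N ∕ f`
  set y : w.1.adicCompletion L := (ϖ : w.1.adicCompletion L) ^ N / f with hydef
  have hdisc_eq : t ^ 2 - 4 * D = y * y * toPlace v w ε₀ := by
    rw [hε₀, hydef, hGdef]
    field_simp
    ring
  have hyv : Valued.v y = WithZero.exp (-(N : ℤ)) := by
    rw [hydef, map_div₀, map_pow, hϖv, hfv, div_one, ← WithZero.exp_nsmul]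
    simp
  have hε₀v : Valued.v (toPlace v w ε₀) = 1 := by
    have h := hdisc
    rw [hdisc_eq, map_mul, map_mul, hyv, ← WithZero.exp_add] at h
    have hne : WithZero.exp (-(N : ℤ) + -(N : ℤ)) ≠ 0 := WithZero.coe_ne_zero
    have h' : WithZero.exp (-(N : ℤ) + -(N : ℤ)) * Valued.v (toPlace v w ε₀) = WithZero.exp (-(N : ℤ) + -(N : ℤ)) * 1 := by
      rw [h, mul_one]; congr 1; push_cast; ring
    exact mul_left_cancel₀ hne h'
  refine ⟨y, ε₀, fun b hb => ?_, by linear_combination -hdisc_eq, hyv, ?_⟩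
  · -- residue non-square: else `|disc − (b y)²| < |disc|`
    have hle : Valued.v (b * b - toPlace v w ε₀) ≤ 1 := by
      refine (Valued.v.map_sub _ _).trans (max_le ?_ hε₀v.le)
      rw [map_mul]; exact mul_le_one' hb hb
    refine le_antisymm hle (not_lt.1 fun hlt => ?_)
    have h := hsq (b * y)
    have hL : Valued.v (y * y * toPlace v w ε₀) = Valued.v y * Valued.v y := by rw [map_mul, map_mul, hε₀v, mul_one]
    have hR : Valued.v (y * y * toPlace v w ε₀ - (b * y) ^ 2) = Valued.v y * Valued.v y * Valued.v (b * b - toPlace v w ε₀) := by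
      rw [show y * y * toPlace v w ε₀ - (b * y) ^ 2 = -(y * y * (b * b - toPlace v w ε₀)) by ring, Valuation.map_neg, map_mul, map_mul]
    rw [hdisc_eq, hL, hR] at h
    have hy0 : Valued.v y ≠ 0 := by rw [hyv]; exact WithZero.coe_ne_zero
    have hyy : 0 < Valued.v y * Valued.v y := pos_iff_ne_zero.2 (mul_ne_zero hy0 hy0)
    have h' : Valued.v y * Valued.v y * 1 ≤ Valued.v y * Valued.v y * Valued.v (b * b - toPlace v w ε₀) := by rwa [mul_one]
    exact absurd (le_of_mul_le_mul_left h' hyy) (not_le.2 hlt)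
  · -- the type bit: `σy = (−1)^N · y · σD`
    rw [hydef, map_div₀, map_pow, hσϖ, hσf, hσD', neg_pow]
    field_simp

/-! ## §2 The eigenvalue norm identity `λ·s̃λ = 1` from the skew data (pure algebra) -/

/-- **`λ·s̃λ = 1` FROM THE SKEW SQUARE ROOT** (★ (D5)-ram's binder `hlam1`): over commutative rings `E →[ι₁] K` with ring endomorphisms `σ` of `E` and `s̃` of `K`,
`s̃ ∘ ι₁ = ι₁ ∘ σ`, `θ² = ι₁ ε`, `s̃θ = −((−1)^N·θ)`, `4D = t·t − y·y·ε`, `DσD = 1`, `σt = tσD`, `σy = (−1)^N·(y·σD)`, `e₂·2 = 1`: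
`λ·s̃λ = 1` for `λ := (ι₁t + ι₁y·θ)·ι₁e₂` — indeed `s̃λ = ι₁e₂·ι₁σD·(ι₁t − ι₁y·θ)` and `(t + yθ)(t − yθ) = t² − y²ε = 4D`.
[cite: Rogawski1990, §4.9 Lemma 4.9.3 p. 56] -/
theorem mul_map_mul_eq_one_of_skew_sqrt {E K : Type*} [CommRing E] [CommRing K] (σ : E →+* E) (ι₁ : E →+* K) (s' : K →+* K)
    (hs'ι : ∀ x, s' (ι₁ x) = ι₁ (σ x)) {θ : K} {ε t D y e₂ : E} {N : ℕ}
    (hθ : θ ^ 2 = ι₁ ε) (hs'θ : s' θ = -((-1) ^ N * θ))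
    (hD : 4 * D = t * t - y * y * ε) (hσD : D * σ D = 1) (hσt : σ t = t * σ D) (hσy : σ y = (-1) ^ N * (y * σ D))
    (h2e : e₂ * 2 = 1) :
    ((ι₁ t + ι₁ y * θ) * ι₁ e₂) * s' ((ι₁ t + ι₁ y * θ) * ι₁ e₂) = 1 := by
  -- `σ e₂ = e₂` (both are inverses of `2`)
  have hσe : σ e₂ = e₂ := by
    have h1 : σ e₂ * 2 = 1 := by rw [← map_ofNat σ 2, ← map_mul, h2e, map_one]
    calc σ e₂ = σ e₂ * (e₂ * 2) := by rw [h2e, mul_one]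
      _ = e₂ * (σ e₂ * 2) := by ring
      _ = e₂ := by rw [h1, mul_one]
  have hs2 : ((-1 : K) ^ N) * ((-1 : K) ^ N) = 1 := by rw [← mul_pow, neg_one_mul, neg_neg, one_pow]
  have hD' : 4 * ι₁ D = ι₁ t * ι₁ t - ι₁ y * ι₁ y * ι₁ ε := by
    have h := congrArg ι₁ hD; simp only [map_mul, map_sub, map_ofNat] at h; exact h
  have hσD'' : ι₁ D * ι₁ (σ D) = 1 := by rw [← map_mul, hσD, map_one]
  have h2e' : ι₁ e₂ * 2 = 1 := by rw [← map_ofNat ι₁ 2, ← map_mul, h2e, map_one]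
  rw [map_mul, map_add, map_mul, hs'ι, hs'ι, hs'ι, hs'θ, hσt, hσy, hσe, map_mul, map_mul, map_mul, map_pow, map_neg, map_one]
  linear_combination (-(ι₁ e₂ * ι₁ e₂ * ι₁ (σ D) * (ι₁ t + ι₁ y * θ) * (ι₁ y * θ))) * hs2
    + (-(ι₁ e₂ * ι₁ e₂ * ι₁ (σ D) * (ι₁ y * ι₁ y))) * hθ + (-(ι₁ e₂ * ι₁ e₂ * ι₁ (σ D))) * hD'
    + (4 * ι₁ e₂ * ι₁ e₂) * hσD'' + (2 * ι₁ e₂ + 1) * h2e'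

/-- **Type A** (`N` odd, `s̃θ = θ`, `σy = −(y·σD)`): `λ·s̃λ = 1`. [cite: Rogawski1990, §4.9 Lemma 4.9.3 p. 56] -/
theorem mul_map_mul_eq_one_of_skew_sqrt_typeA {E K : Type*} [CommRing E] [CommRing K] (σ : E →+* E) (ι₁ : E →+* K) (s' : K →+* K)
    (hs'ι : ∀ x, s' (ι₁ x) = ι₁ (σ x)) {θ : K} {ε t D y e₂ : E} {N : ℕ} (hN : Odd N)
    (hθ : θ ^ 2 = ι₁ ε) (hs'θ : s' θ = θ)
    (hD : 4 * D = t * t - y * y * ε) (hσD : D * σ D = 1) (hσt : σ t = t * σ D) (hσy : σ y = -(y * σ D))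
    (h2e : e₂ * 2 = 1) :
    ((ι₁ t + ι₁ y * θ) * ι₁ e₂) * s' ((ι₁ t + ι₁ y * θ) * ι₁ e₂) = 1 :=
  mul_map_mul_eq_one_of_skew_sqrt σ ι₁ s' hs'ι (N := N) hθ (by rw [hN.neg_one_pow, neg_mul, one_mul, neg_neg]; exact hs'θ)
    hD hσD hσt (by rw [hN.neg_one_pow, neg_mul, one_mul]; exact hσy) h2e

/-- **Type B** (`N` even, `s̃θ = −θ`, `σy = y·σD`): `λ·s̃λ = 1`. [cite: Rogawski1990, §4.9 Lemma 4.9.3 p. 56] -/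
theorem mul_map_mul_eq_one_of_skew_sqrt_typeB {E K : Type*} [CommRing E] [CommRing K] (σ : E →+* E) (ι₁ : E →+* K) (s' : K →+* K)
    (hs'ι : ∀ x, s' (ι₁ x) = ι₁ (σ x)) {θ : K} {ε t D y e₂ : E} {N : ℕ} (hN : Even N)
    (hθ : θ ^ 2 = ι₁ ε) (hs'θ : s' θ = -θ)
    (hD : 4 * D = t * t - y * y * ε) (hσD : D * σ D = 1) (hσt : σ t = t * σ D) (hσy : σ y = y * σ D)
    (h2e : e₂ * 2 = 1) :
    ((ι₁ t + ι₁ y * θ) * ι₁ e₂) * s' ((ι₁ t + ι₁ y * θ) * ι₁ e₂) = 1 :=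
  mul_map_mul_eq_one_of_skew_sqrt σ ι₁ s' hs'ι (N := N) hθ (by rw [hN.neg_one_pow, one_mul]; exact hs'θ)
    hD hσD hσt (by rw [hN.neg_one_pow, one_mul]; exact hσy) h2e

end Literature.NumberTheory.LocalFields

end
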